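import Literature.MathematicalPhysics.QuantumFieldTheory.Balaban1983to89.Node00.TorusCoverLandau153
import Literature.MathematicalPhysics.QuantumFieldTheory.Balaban1983to89.Node00.TorusCoverLocalGaugePrint

/-!
# NODE 00 — THE TORUS→`ℤᵈ` TWIN AT PRINT'S CUBES, (152)₄ + (153): the window-generic push-down of FILE P2 (`Node00.TorusCoverLocalGaugePrint`) WITH [15] (152)'s
# Laplacian member and the gauge condition (153) ∕ [6] (1.38) of the lift, and [6] PROPOSITION 6 ON PRINT'S CLASS (`zdCubP 𝔸 L ρ₀`) ⇒ the six clauses on a grid cube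

Cell `pub-ymgap`, width seat `pub-ymgap-dag-n07-w3` generation 0 (HUMAN RULING D-0149 ∕ director-ym №197; DAG node N07 = [15]; cell INBOX INTENT-4 of 2026-08-28, on dag-n07-e
g15's word «its print-cube edition is the same swap `propCube ↦ propCubeP`, `zdCub ↦ zdCubP ρ` … yours to call»).  NEW leaf, PROOF kind (no `def`); CONSUMED BY NAME, nothing
modified: this seat's `Node00.TorusCoverLandau153` (`exists_suGauge_letters152_153_of_gaugedBoundB8`, `covLap_one_apply`), dag-n07-e's FILE P1 `Node00.TorusCoverCubeMemberPrint`
(`propCubeP`, `cubeIdxP'`, `isPrint_propCubeP`, `cubeExt_subset_box_propCubeP`) and FILE P2 `Node00.TorusCoverLocalGaugePrint` (the window hypotheses `hinj`∕`hfwd`∕`hbwd` shape,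
`codiffCurlA_cover_eq_pdiv_of_window`), k0-s2-w2's `Node00.CarriersB8CubePrint` (`zdCubP`, `prop6Printed_zdCubP_iff`, `CubeB8.IsPrint.of_dvd`), FILES 25∕26∕28b∕34b (`zdLift`,
`inAk_zdLift_of_top`, `tol_of_level_pred`, `eq_of_cover_eq_of_mem_cubeExt`, `add_e_mem_cubeExt_of_shift_mem_image`, `sub_e_mem_cubeExt_of_unshift_mem_image`, `cfgExp_eq_expI`,
`zdLift_mem_specialUnitaryUnits`, `cover_add_e`, `cover_sub_e`), 33b (`Sect2.codiffCurlA`, `Sect2.bondsDeep`), N05's `B8Eq138LandauZd.IsLandau138`, r15's `cover`, def-R's `cubeEnl`,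
def-P11's `Sect2.regionOfSet`, r11's `gaugeU ∕ expI ∕ grad`.  `--kind proof --supports stmt-QuantumFields-20542 --as helper` (K1⁷; count-neutral).
[15] = [Balaban1985Variational]; [6] = [Balaban1985RegularSpaces]; [I] = [Balaban1987RG1].

WHY.  `Node00.TorusCoverLandau153` carried [15] (152)'s fourth member `|Δ^ηA|` ([6] (1.136)₄ = `GaugedBoundB8`'s tenth conjunct) and the gauge condition (153) «R ∂^{η*}A = 0»
([6] (1.38) = the fourth conjunct, in N05's `ℤᵈ` multiplier form, for the LIFT of the potential) through 34b's push-down AT ONE DATUM (`propCube`, collar `L`).  The repair of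
record (R-b) reads [6] Proposition 6 on PRINT's cube class only (`zdCubP 𝔸 L ρ₀`; k0-s2-w2 ∕ dag-n07-e FILES P1–P3), at the print datum `propCubeP` (collar a print big block
`ρ ≥ L`); FILE P2 made the push-down DATUM- and WINDOW-generic for the four averaging-free letters of (152).  THIS FILE is the same for the SIX clauses: §1 states the push-down
once for an ARBITRARY `CubeB8` datum `c` of scale `c.k = n` and an arbitrary cover-injective step-closed window `X ⊆ 𝔔` (FILE P2's `hinj`∕`hfwd`∕`hbwd`), from `GaugedBoundB8 L η_n
(zdLift N U) c r` and the `2π`-window: the gauge equation, `‖A‖`, `‖∇^{η_n}A‖`, `‖∂^{η_n*}∂^{η_n}A‖`, `‖Δ^{η_n}A‖` (r11's `grad` letters, inline) at `2r` on `π(X)`, AND a `ℤᵈ`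
potential `A′` with `A ⟨π x, μ⟩ = A′ x μ` on `X` in the (153)-gauge `IsLandau138 L c.k η_n (c.sq 0) c.lamS 1 A′` of the datum (MEMBER currency — the linearised [4]-averaging's
transpose `QT`; plan g79's ruling of record); §2 feeds it from Proposition 6 ON PRINT'S CLASS at `propCubeP` exactly as FILE P2 §2 does.  `Node00.TorusCoverLandau153` §3 is the
instance `c := propCube`, `X := cubeExt (LⁿM) a 0` of §1.

CONTENTS.  §1 `lap_cover_eq_covLap_of_window` · ★★ `exists_localGauge152_153_window_of_gaugedBoundB8` · ★★ `exists_localGauge152_153_cube_of_gaugedBoundB8`.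
§2 ★★★ `exists_localGauge152_153_cube_of_prop6P`.

HONEST FRAMING: compositions by name; [6] Proposition 6 on print's class at the member is the HYPOTHESIS `hG` ∕ `hP6` (N05's node ∕ K0⁷ stub 2′'s body at `ρ₀`; never asserted
here); (153) is carried for the `ℤᵈ` LIFT on the datum's largest cube `□₀ = c.sq 0` in MEMBER currency — NO torus-native operator `R`, no averaging dictionary claimed
([I] pp.253–254 is print's licence, not a kernel fact); nothing of Bałaban discharged; stub 2′ ∕ N07 ∕ N05 ∕ K0⁷ ∕ K1⁷ NOT closed; counts unmoved (5∕27); one finite T⁴ programme at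
fixed ε — NOT continuum ∕ ℝ⁴ ∕ infinite volume ∕ OS ∕ mass gap ∕ Clay.  No `sorry`, no `def`, no `instance`, no `notation`.
-/

noncomputable section

namespace Literature.MathematicalPhysics.QuantumFieldTheory.Balaban1983to89.Node00

open scoped Matrix.Norms.L2Operator
open Complex (I)
open B7Prop1Explicit (e e_apply)
open B7Prop1Local (InBox)
open B7Prop2Explicit (unitaryUnits mem_unitaryUnits)
open B7Prop2SpecialUnitary (specialUnitaryUnits mem_specialUnitaryUnits)
open B8Ineq132 (InAk)
open B8Eq131Cubes (box tcube bLo bHi)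
open B8Eq184Proof (cfgExp)
open B8Eq146AExpansion (plaqCovDeriv)
open B8Eq143PlaqExpansion (pdiv)
open B8Eq138LandauZd (covLap IsLandau138)
open B15Eq112TorusCover (cover)
open B14DomainGeom (Pt)
open B14.Eq213MaximalDomains (side cubeExt)
open B12RegularSpaces111 (gaugeU expI grad)
open B8LeafModelZd (ZdIdx)

variable {P : Params} {N : ℕ} [NeZero N]

/-! ## §1  ★★ The six-clause push-down, datum- and window-generic -/

section PushDown

omit [NeZero N] in
/-- `Node00.TorusCoverLandau153`'s `lap_cover_eq_covLap` for an ARBITRARY window `X ⊆ ℤᵈ`: for a torus potential `A` that is the `cover`-push-forward of `A′` on `X`, at `π x` with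
`x`, `x ± e_ν ∈ X`, the Laplacian member in r11's `grad` letters `Σ_ν η⁻¹[(∇^η_νA_μ)((π x) − e_ν) − (∇^η_νA_μ)(π x)]` IS lit-balaban's `covLap η 1 (A′ · μ) x`.
[cite: Balaban1985BackgroundPropagators, (3.23) p.394; Balaban1985RegularSpaces, (1.136) p.99 (bookkeeping under the cover)] -/
theorem lap_cover_eq_covLap_of_window (η : ℝ) {X : Set (Pt P.d)} {A : PBond P 0 → MatA N} {A' : B7Prop1Explicit.Site P.d → Fin P.d → MatA N}
    (hA : ∀ z, z ∈ X → ∀ κ, A ⟨cover P z, κ⟩ = A' z κ) {x : B7Prop1Explicit.Site P.d}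
    (hx : x ∈ X) (hν : ∀ ν, x + e ν ∈ X ∧ x - e ν ∈ X) (μ : Fin P.d) :
    ∑ ν : Fin P.d, ((η : ℝ) : ℂ)⁻¹ • (grad η ν (fun y => A ⟨y, μ⟩) ((cover P x).unshift ν) - grad η ν (fun y => A ⟨y, μ⟩) (cover P x)) =
      covLap η (1 : B7Prop1Explicit.Site P.d → Fin P.d → (MatA N)ˣ) (fun z => A' z μ) x := by
  rw [covLap_one_apply]
  refine Finset.sum_congr rfl fun ν _ => ?_
  obtain ⟨h1, h2⟩ := hν ν
  rw [← cover_sub_e, grad, grad, ← cover_add_e, ← cover_add_e, sub_add_cancel]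
  simp only [hA _ hx, hA _ h1, hA _ h2, ← Complex.ofReal_inv, Complex.coe_smul]

/-- ★★ **THE SIX-CLAUSE PUSH-DOWN, FOR AN ARBITRARY CUBE DATUM AND AN ARBITRARY COVER-INJECTIVE STEP-CLOSED WINDOW** — FILE P2's `exists_localGauge10_window_of_gaugedBoundB8`
(same hypotheses BYTE FOR BYTE: `d ≥ 2`; a `CubeB8` datum `c` with `c.k = n`; `0 ≤ r`; `GaugedBoundB8 L η_n (zdLift N U) c r`; a window `X ⊆ box L c.a c.M c.k` with `hinj`∕`hfwd`∕
`hbwd`; the `2π`-window) with TWO more conclusions for the SAME `u`, `A`: the Laplacian member `‖Σ_ν η_n⁻¹[(∇^{η_n}_νA_μ)(x − e_ν) − (∇^{η_n}_νA_μ)(x)]‖ ≤ 2r` on `Sect2.bondsDeep (π X)`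
([15] (152) fourth member ∕ [6] (1.136)₄) and «`∃ A′`, `A ⟨π x, μ⟩ = A′ x μ` on `X` ∧ `IsLandau138 L c.k η_n (c.sq 0) c.lamS 1 A′`» ([15] (153) ∕ [6] (1.38) for the lift, MEMBER
currency).  Source: `exists_suGauge_letters152_153_of_gaugedBoundB8` pushed down exactly as in FILE P2.
[cite: Balaban1985Variational, (144)–(153) pp.300–301, Thm 1 (9)–(10) p.279; Balaban1985RegularSpaces, Prop. 6 (1.135)–(1.138) p.99, (1.38) p.82; Balaban1987RG1, (0.1) p.251] -/
theorem exists_localGauge152_153_window_of_gaugedBoundB8 (hd : 2 ≤ P.d) {K' : ℕ} {Ω' : ℕ → Set (B7Prop1Explicit.Site P.d)} (c : CubeB8 P.d P.L K' Ω')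
    (U : GaugeField P 0 (SU N)) {n : ℕ} (hk : c.k = n) {r : ℝ} (hr : 0 ≤ r)
    (hG : letI : CStarAlgebra (MatA N) := {}; GaugedBoundB8 P.L (P.eta n) (zdLift N U) c r)
    {X : Set (Pt P.d)} (hinj : ∀ ⦃x⦄, x ∈ X → ∀ ⦃x'⦄, x' ∈ X → cover P x = cover P x' → x = x')
    (hfwd : ∀ ⦃x⦄, x ∈ X → ∀ μ, (cover P x).shift μ ∈ cover P '' X → x + e μ ∈ X)
    (hbwd : ∀ ⦃x⦄, x ∈ X → ∀ ν, (cover P x).unshift ν ∈ cover P '' X → x - e ν ∈ X)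
    (hbox : X ⊆ box P.L c.a c.M c.k)
    (h2π : (2 * boxWidth (bLo P.L c.a c.k 0) (bHi P.L c.a c.M c.k 0) + 1) * (P.eta n * N * (r * ((P.L : ℝ) ^ c.k * P.eta n)⁻¹)) < 2 * Real.pi) :
    ∃ u : GaugeTransf P 0 (SU N), ∃ A : PBond P 0 → MatA N,
      (∀ b ∈ (Sect2.regionOfSet P (cover P '' X)).bonds, gaugeU (fun x => ιSU N (u x)) (fun b' => ιSU N (U b')) b = expI (P.eta n) (A b)) ∧
      (∀ b ∈ (Sect2.regionOfSet P (cover P '' X)).bonds, ‖A b‖ ≤ 2 * r) ∧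
      (∀ q ∈ (Sect2.regionOfSet P (cover P '' X)).dpairs, ‖grad (P.eta n) q.2.1 (fun y => A ⟨y, q.2.2⟩) q.1‖ ≤ 2 * r) ∧
      (∀ b ∈ Sect2.bondsDeep (cover P '' X), ‖Sect2.codiffCurlA (P.eta n) A b.src b.dir‖ ≤ 2 * r) ∧
      (∀ b ∈ Sect2.bondsDeep (cover P '' X),
          ‖∑ ν : Fin P.d, ((P.eta n : ℝ) : ℂ)⁻¹ •
              (grad (P.eta n) ν (fun y => A ⟨y, b.dir⟩) (b.src.unshift ν) - grad (P.eta n) ν (fun y => A ⟨y, b.dir⟩) b.src)‖ ≤ 2 * r) ∧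
      ∃ A' : B7Prop1Explicit.Site P.d → Fin P.d → MatA N,
        (∀ x, x ∈ X → ∀ μ, A ⟨cover P x, μ⟩ = A' x μ) ∧
        IsLandau138 P.L c.k (P.eta n) (c.sq 0) c.lamS (1 : B7Prop1Explicit.Site P.d → Fin P.d → (MatA N)ˣ) A' := by
  classical
  letI : CStarAlgebra (MatA N) := {}
  have hL : 2 ≤ P.L := P.hL.2
  have hηpos : 0 < P.eta n := B3GkZeroTorusRescaled.eta_pos P n
  set V := zdLift N U with hV
  obtain ⟨s, A', h1, h2, h3, h4, h4', h5⟩ :=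
    exists_suGauge_letters152_153_of_gaugedBoundB8 hd hL c V (zdLift_mem_specialUnitaryUnits U) hηpos hr hG h2π
  have hscale : (P.L : ℝ) ^ c.k * P.eta n = 1 := by rw [hk]; exact B12Eq115BackgroundPair.pow_mul_eta P n
  simp only [hscale, inv_one, mul_one, one_pow] at h2 h3 h4 h4'
  -- push-down through the cover (injective on the window)
  let u : GaugeTransf P 0 (SU N) := fun y =>
    if h : ∃ x, x ∈ X ∧ cover P x = y then s (Classical.choose h) else 1
  let A : PBond P 0 → MatA N := fun b =>
    if h : ∃ x, x ∈ X ∧ cover P x = b.src then A' (Classical.choose h) b.dir else 0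
  have hu : ∀ x, x ∈ X → u (cover P x) = s x := by
    intro x hx
    have hex : ∃ x', x' ∈ X ∧ cover P x' = cover P x := ⟨x, hx, rfl⟩
    simp only [u, dif_pos hex]
    rw [hinj (Classical.choose_spec hex).1 hx (Classical.choose_spec hex).2]
  have hA : ∀ x, x ∈ X → ∀ μ, A ⟨cover P x, μ⟩ = A' x μ := by
    intro x hx μ
    have hex : ∃ x', x' ∈ X ∧ cover P x' = cover P x := ⟨x, hx, rfl⟩
    simp only [A, dif_pos hex]
    rw [hinj (Classical.choose_spec hex).1 hx (Classical.choose_spec hex).2]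
  have hlift : ∀ y, y ∈ cover P '' X → ∃ x, x ∈ X ∧ cover P x = y := fun y ⟨x, hx, hxy⟩ => ⟨x, hx, hxy⟩
  refine ⟨u, A, fun b hb => ?_, fun b hb => ?_, fun q hq => ?_, fun b hb => ?_, fun b hb => ?_, A', hA, h5⟩
  · obtain ⟨x, hx, hxs⟩ := hlift b.src hb.1
    have hx' : x + e b.dir ∈ X := hfwd hx b.dir (by rw [hxs]; exact hb.2)
    have hb' : b = ⟨cover P x, b.dir⟩ := by cases b; simp only at hxs; rw [hxs]
    rw [hb', hA x hx]
    have hgauge := h1 x b.dir (hbox hx) (hbox hx')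
    rw [cfgExp_eq_expI] at hgauge
    rw [← hgauge]
    simp only [gaugeU, B7Prop1Explicit.gaugeAct, PBond.tgt, ← cover_add_e, hu x hx, hu (x + e b.dir) hx', hV, zdLift_apply]
  · obtain ⟨x, hx, hxs⟩ := hlift b.src hb.1
    have hx' : x + e b.dir ∈ X := hfwd hx b.dir (by rw [hxs]; exact hb.2)
    have hb' : b = ⟨cover P x, b.dir⟩ := by cases b; simp only at hxs; rw [hxs]
    rw [hb', hA x hx]
    exact h2 x b.dir (hbox hx) (hbox hx')
  · obtain ⟨hq1, hq2, hq3, -⟩ := hq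
    obtain ⟨x, hx, hxs⟩ := hlift q.1 hq1
    have hxμ : x + e q.2.1 ∈ X := hfwd hx q.2.1 (by rw [hxs]; exact hq2)
    have hxν : x + e q.2.2 ∈ X := hfwd hx q.2.2 (by rw [hxs]; exact hq3)
    rw [grad, ← hxs, ← cover_add_e, hA x hx, hA (x + e q.2.1) hxμ, norm_smul, norm_inv, Complex.norm_real, Real.norm_eq_abs, abs_of_pos hηpos]
    calc (P.eta n)⁻¹ * ‖A' (x + e q.2.1) q.2.2 - A' x q.2.2‖ ≤ (P.eta n)⁻¹ * (2 * (P.eta n * r)) :=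
          mul_le_mul_of_nonneg_left (h3 x q.2.1 q.2.2 (hbox hx) (hbox hxμ) (hbox hxν)) (inv_nonneg.2 hηpos.le)
      _ = 2 * r := by field_simp
  · obtain ⟨hb1, hb2, hbν⟩ := hb
    obtain ⟨x, hx, hxs⟩ := hlift b.src hb1
    have hxμ : x + e b.dir ∈ X := hfwd hx b.dir (by rw [hxs]; exact hb2)
    have hstencil : ∀ ν, x + e ν ∈ X ∧ x - e ν ∈ X ∧ x - e ν + e b.dir ∈ X := by
      intro ν
      obtain ⟨s1, s2, s3, s4⟩ := hbν ν
      have hxν : x + e ν ∈ X := hfwd hx ν (by rw [hxs]; exact s1)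
      have hxν' : x - e ν ∈ X := hbwd hx ν (by rw [hxs]; exact s2)
      have hxν'' : x - e ν + e b.dir ∈ X :=
        hfwd hxν' b.dir (by
          rw [cover_sub_e, hxs, ← Site.unshift_shift_comm]
          exact s4)
      exact ⟨hxν, hxν', hxν''⟩
    have hb' : b = ⟨cover P x, b.dir⟩ := by cases b; simp only at hxs; rw [hxs]
    rw [hb']
    show ‖Sect2.codiffCurlA (P.eta n) A (cover P x) b.dir‖ ≤ 2 * r
    rw [codiffCurlA_cover_eq_pdiv_of_window (P.eta n) hA hx hxμ hstencil]
    exact h4 x b.dir (hbox hx) (hbox hxμ) fun ν => ⟨hbox (hstencil ν).1, hbox (hstencil ν).2.1, hbox (hstencil ν).2.2⟩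
  · obtain ⟨hb1, hb2, hbν⟩ := hb
    obtain ⟨x, hx, hxs⟩ := hlift b.src hb1
    have hxμ : x + e b.dir ∈ X := hfwd hx b.dir (by rw [hxs]; exact hb2)
    have hstencil : ∀ ν, x + e ν ∈ X ∧ x - e ν ∈ X := by
      intro ν
      obtain ⟨s1, s2, -, -⟩ := hbν ν
      exact ⟨hfwd hx ν (by rw [hxs]; exact s1), hbwd hx ν (by rw [hxs]; exact s2)⟩
    have hb' : b = ⟨cover P x, b.dir⟩ := by cases b; simp only at hxs; rw [hxs]
    rw [hb']
    show ‖∑ ν : Fin P.d, ((P.eta n : ℝ) : ℂ)⁻¹ •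
        (grad (P.eta n) ν (fun y => A ⟨y, b.dir⟩) ((cover P x).unshift ν) - grad (P.eta n) ν (fun y => A ⟨y, b.dir⟩) (cover P x))‖ ≤ 2 * r
    rw [lap_cover_eq_covLap_of_window (P.eta n) hA hx hstencil]
    exact h4' x b.dir (hbox hx) (hbox hxμ) fun ν => ⟨hbox (hstencil ν).1, hbox (hstencil ν).2⟩

/-- ★★ **THE SIX-CLAUSE PUSH-DOWN AT A NON-WRAPPING GRID CUBE, FOR AN ARBITRARY CUBE DATUM**: the window `X := cubeExt S a 0` (the lift of `□ = cubeEnl P S a 0`, side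
`S < 2L^{m+K}`; cover-injective and step-closed by FILE 28b ∕ 34b) inside the datum's box.  `Node00.TorusCoverLandau153`'s `exists_localGauge152_153_cube_of_prop6` is its
instance `c := propCube`; §2 below is the instance `c := propCubeP`. [cite: Balaban1985Variational, (144)–(153) pp.300–301; Balaban1985RegularSpaces, Prop. 6 (1.135)–(1.138) p.99; Balaban1987RG1, (0.1) p.251] -/
theorem exists_localGauge152_153_cube_of_gaugedBoundB8 (hd : 2 ≤ P.d) {K' : ℕ} {Ω' : ℕ → Set (B7Prop1Explicit.Site P.d)} (c : CubeB8 P.d P.L K' Ω')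
    (U : GaugeField P 0 (SU N)) {n : ℕ} (hk : c.k = n) {r : ℝ} (hr : 0 ≤ r)
    (hG : letI : CStarAlgebra (MatA N) := {}; GaugedBoundB8 P.L (P.eta n) (zdLift N U) c r)
    {S : ℕ} {a : Pt P.d} (hSN : (S : ℤ) < P.sitesPerDir 0) (hbox : cubeExt S a 0 ⊆ box P.L c.a c.M c.k)
    (h2π : (2 * boxWidth (bLo P.L c.a c.k 0) (bHi P.L c.a c.M c.k 0) + 1) * (P.eta n * N * (r * ((P.L : ℝ) ^ c.k * P.eta n)⁻¹)) < 2 * Real.pi) :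
    ∃ u : GaugeTransf P 0 (SU N), ∃ A : PBond P 0 → MatA N,
      (∀ b ∈ (Sect2.regionOfSet P (cubeEnl P S a 0)).bonds, gaugeU (fun x => ιSU N (u x)) (fun b' => ιSU N (U b')) b = expI (P.eta n) (A b)) ∧
      (∀ b ∈ (Sect2.regionOfSet P (cubeEnl P S a 0)).bonds, ‖A b‖ ≤ 2 * r) ∧
      (∀ q ∈ (Sect2.regionOfSet P (cubeEnl P S a 0)).dpairs, ‖grad (P.eta n) q.2.1 (fun y => A ⟨y, q.2.2⟩) q.1‖ ≤ 2 * r) ∧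
      (∀ b ∈ Sect2.bondsDeep (cubeEnl P S a 0), ‖Sect2.codiffCurlA (P.eta n) A b.src b.dir‖ ≤ 2 * r) ∧
      (∀ b ∈ Sect2.bondsDeep (cubeEnl P S a 0),
          ‖∑ ν : Fin P.d, ((P.eta n : ℝ) : ℂ)⁻¹ •
              (grad (P.eta n) ν (fun y => A ⟨y, b.dir⟩) (b.src.unshift ν) - grad (P.eta n) ν (fun y => A ⟨y, b.dir⟩) b.src)‖ ≤ 2 * r) ∧
      ∃ A' : B7Prop1Explicit.Site P.d → Fin P.d → MatA N,
        (∀ x, x ∈ cubeExt S a 0 → ∀ μ, A ⟨cover P x, μ⟩ = A' x μ) ∧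
        IsLandau138 P.L c.k (P.eta n) (c.sq 0) c.lamS (1 : B7Prop1Explicit.Site P.d → Fin P.d → (MatA N)ˣ) A' := by
  have e0 : cubeEnl P S a 0 = cover P '' cubeExt S a 0 := by simp only [cubeEnl, Nat.zero_mul, Nat.cast_zero]
  rw [e0]
  exact exists_localGauge152_153_window_of_gaugedBoundB8 hd c U hk hr hG (fun x hx x' hx' h => eq_of_cover_eq_of_mem_cubeExt hSN.le hx hx' h)
    (fun x hx μ h => add_e_mem_cubeExt_of_shift_mem_image hSN hx h) (fun x hx ν h => sub_e_mem_cubeExt_of_unshift_mem_image hSN hx h) hbox h2π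

end PushDown

/-! ## §2  ★★★ [6] Proposition 6 ON PRINT'S CLASS ⇒ the six clauses on a grid cube of the torus, at the print datum -/

section PrintCubes

/-- ★★★ **[6] PROPOSITION 6 ON PRINT'S CUBE CLASS AT NODE 00's `ℤᵈ` MEMBER ⇒ THE LOCAL GAUGE OF [15] (152) ON ONE GRID CUBE OF THE TORUS WITH ALL FOUR LETTERS AND THE
(153)-GAUGE OF ITS LIFT** — FILE P2's ★★★ `exists_localGauge10_cube_of_prop6P` (hypotheses BYTE FOR BYTE: `d ≥ 2`; `B8.Prop6Printed d L B₁ c₁ (zdCubP (M_N ℂ) L ρ₀ ·)`; `ρ₀ ∣ ρ`,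
`L ≤ ρ`; the class (1.7)∕(1.9)-Top of `U`; `1 ≤ n ≤ kT + 1`, `0 < ε_{n−1}`; the non-wrapping grid cube `□ = cubeEnl P (LⁿM) a 0` whose PRINT collar projects into the scale-`(n−1)`
level set; «7dL²M′α₀ ≤ c₁» and the `2π`-window at `propCubeP`) with the two extra conclusions of §1: the Laplacian member `‖Δ^{η_n}A‖ ≤ 2r` on the deep bonds (r11's `grad`
letters) and a `ℤᵈ` lift `A′` of `A` in the (153)-gauge `IsLandau138 L c.k η_n (c.sq 0) c.lamS 1 A′` of the print datum `c = propCubeP P n hn M ρ hρ a` (`r = 7dL²B₁M′·L³ε_{n−1}`,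
`M′ = sideP P M ρ`). [cite: Balaban1985Variational, (144)–(153) pp.300–301, Thm 1 (9)–(10) p.279; Balaban1985RegularSpaces, Prop. 6 (1.135)–(1.138) p.99, p.98, (1.38) p.82] -/
theorem exists_localGauge152_153_cube_of_prop6P (hd : 2 ≤ P.d) {B₁ c₁ : ℝ} (hB₁ : 0 ≤ B₁) {ρ₀ ρ : ℕ} (hρ₀ : ρ₀ ∣ ρ) (hρ : P.L ≤ ρ)
    (hP6 : letI : CStarAlgebra (MatA N) := {}; B8.Prop6Printed P.d (P.L : ℝ) B₁ c₁ (fun i : ZdIdx P.d P.L => zdCubP (MatA N) P.L ρ₀ i))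
    {Ω : ℕ → Set (Site P 0)} {Ω₀ : Set (Site P 0)} {kT : ℕ} {ε : ℕ → ℝ} (U : GaugeField P 0 (SU N))
    (hP : ∀ m, m ≤ kT → PlaqSmallOn (Sect2.omegaPlaqsTop Ω Ω₀ m) (ε m * P.eta m ^ 2) U)
    (hD : ∀ m, m ≤ kT → Sect2.CoDivSmallOn (Sect2.omegaBondsTop Ω Ω₀ m) (ε m * P.eta m ^ 3) U)
    {n : ℕ} (hn : 1 ≤ n) (hnk : n ≤ kT + 1) (hε : 0 < ε (n - 1)) {M : ℕ} (a : Pt P.d)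
    (hSN : ((side P.L M n : ℕ) : ℤ) < P.sitesPerDir 0)
    (hcollar : cover P '' (cubeIdxP' P n hn M ρ a).Ω 0 ⊆ (if n - 1 = 0 then Ω₀ else Ω (n - 1)))
    (hc₁ : 7 * P.d * (P.L : ℝ) ^ 2 * (propCubeP P n hn M ρ hρ a).M * ((P.L : ℝ) ^ 3 * ε (n - 1)) ≤ c₁)
    (h2π : (2 * boxWidth (bLo P.L (propCubeP P n hn M ρ hρ a).a (propCubeP P n hn M ρ hρ a).k 0)
        (bHi P.L (propCubeP P n hn M ρ hρ a).a (propCubeP P n hn M ρ hρ a).M (propCubeP P n hn M ρ hρ a).k 0) + 1) *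
        (P.eta n * N * (7 * P.d * (P.L : ℝ) ^ 2 * B₁ * (propCubeP P n hn M ρ hρ a).M * ((P.L : ℝ) ^ 3 * ε (n - 1)) *
          ((P.L : ℝ) ^ (propCubeP P n hn M ρ hρ a).k * P.eta n)⁻¹)) < 2 * Real.pi) :
    ∃ u : GaugeTransf P 0 (SU N), ∃ A : PBond P 0 → MatA N,
      (∀ b ∈ (Sect2.regionOfSet P (cubeEnl P (side P.L M n) a 0)).bonds,
          gaugeU (fun x => ιSU N (u x)) (fun b' => ιSU N (U b')) b = expI (P.eta n) (A b)) ∧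
      (∀ b ∈ (Sect2.regionOfSet P (cubeEnl P (side P.L M n) a 0)).bonds,
          ‖A b‖ ≤ 2 * (7 * P.d * (P.L : ℝ) ^ 2 * B₁ * (propCubeP P n hn M ρ hρ a).M * ((P.L : ℝ) ^ 3 * ε (n - 1)))) ∧
      (∀ q ∈ (Sect2.regionOfSet P (cubeEnl P (side P.L M n) a 0)).dpairs,
          ‖grad (P.eta n) q.2.1 (fun y => A ⟨y, q.2.2⟩) q.1‖ ≤ 2 * (7 * P.d * (P.L : ℝ) ^ 2 * B₁ * (propCubeP P n hn M ρ hρ a).M * ((P.L : ℝ) ^ 3 * ε (n - 1)))) ∧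
      (∀ b ∈ Sect2.bondsDeep (cubeEnl P (side P.L M n) a 0),
          ‖Sect2.codiffCurlA (P.eta n) A b.src b.dir‖ ≤ 2 * (7 * P.d * (P.L : ℝ) ^ 2 * B₁ * (propCubeP P n hn M ρ hρ a).M * ((P.L : ℝ) ^ 3 * ε (n - 1)))) ∧
      (∀ b ∈ Sect2.bondsDeep (cubeEnl P (side P.L M n) a 0),
          ‖∑ ν : Fin P.d, ((P.eta n : ℝ) : ℂ)⁻¹ •
              (grad (P.eta n) ν (fun y => A ⟨y, b.dir⟩) (b.src.unshift ν) - grad (P.eta n) ν (fun y => A ⟨y, b.dir⟩) b.src)‖ ≤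
            2 * (7 * P.d * (P.L : ℝ) ^ 2 * B₁ * (propCubeP P n hn M ρ hρ a).M * ((P.L : ℝ) ^ 3 * ε (n - 1)))) ∧
      ∃ A' : B7Prop1Explicit.Site P.d → Fin P.d → MatA N,
        (∀ x, x ∈ cubeExt (side P.L M n) a 0 → ∀ μ, A ⟨cover P x, μ⟩ = A' x μ) ∧
        IsLandau138 P.L (propCubeP P n hn M ρ hρ a).k (P.eta n) ((propCubeP P n hn M ρ hρ a).sq 0) (propCubeP P n hn M ρ hρ a).lamS
          (1 : B7Prop1Explicit.Site P.d → Fin P.d → (MatA N)ˣ) A' := by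
  letI : CStarAlgebra (MatA N) := {}
  have hηpos : 0 < P.eta n := B3GkZeroTorusRescaled.eta_pos P n
  -- the member, the datum, the lift in the class
  set i : ZdIdx P.d P.L := cubeIdxP' P n hn M ρ a with hi
  set c := propCubeP P n hn M ρ hρ a with hc
  set α : ℝ := (P.L : ℝ) ^ 3 * ε (n - 1) with hα
  have hαpos : 0 < α := mul_pos (pow_pos (by exact_mod_cast P.L_pos) 3) hε
  have hInAk : InAk P.L i.k i.η α i.Ω (zdLift N U) :=
    inAk_zdLift_of_top U hP hD hηpos (lvl := fun _ => n - 1) (fun j _ => by omega) (fun j _ => hcollar)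
      (fun j hj => (tol_of_level_pred P hn hε.le hj).1) (fun j hj => (tol_of_level_pred P hn hε.le hj).2)
  have hVU : ∀ x κ, zdLift N U x κ ∈ unitaryUnits (MatA N) := fun x κ => zdLift_mem_unitaryUnits U x κ
  -- [6] Proposition 6 ON PRINT'S CLASS at the member and the (print) datum
  have hprint : c.IsPrint ρ₀ := (isPrint_propCubeP P n hn M ρ hρ a).of_dvd hρ₀
  have hG : GaugedBoundB8 P.L i.η (zdLift N U) c (7 * P.d * (P.L : ℝ) ^ 2 * B₁ * c.M * α) :=
    (prop6Printed_zdCubP_iff (fun i : ZdIdx P.d P.L => i) ρ₀ B₁ c₁).1 hP6 i α hαpos ⟨zdLift N U, hVU⟩ hInAk c hprint hc₁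
  have hr0 : 0 ≤ 7 * P.d * (P.L : ℝ) ^ 2 * B₁ * c.M * α := by positivity
  exact exists_localGauge152_153_cube_of_gaugedBoundB8 hd c U rfl hr0 hG hSN (cubeExt_subset_box_propCubeP P n hn M ρ hρ a) h2π

end PrintCubes

end Literature.MathematicalPhysics.QuantumFieldTheory.Balaban1983to89.Node00

end
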